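import Mathlib
import HarnessLib
import Summits.Ventures.LatticeQCDFlow.Exactness.IMHColdStartInvariantEvents
import Summits.Ventures.LatticeQCDFlow.Scaling.AutoregressiveGaugeAllClosingColdExact

/-!
# LatticeQCDFlow / Scaling — the cold-started exact all-closing conditioner: the cold start is invisible to shift-invariant statistics of the run, `A = Z/∏_ℓ c_{#C_ℓ}`

HONEST FRAMING: exact (Metropolis-corrected) sampling algorithms for lattice gauge theory;
figures of merit are autocorrelation/cost numbers at stated couplings and volumes; no
continuum-physics claim.

Venture `LatticeQCDFlow` (cell pub-lqcd), topic `Scaling`, FANOUT row 30 (lean-1, GEN-33) — OUR WORK, the gauge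
instance of this generation's abstract `Exactness/` files.  Setting: `L ≥ 2`; `w` a continuous class-function weight with `0 < m ≤ w ≤ M`,
`w(g⁻¹) = w(g)`; `(T, C)` an all-closing structure (every plaquette closed by exactly one tree link); target
`π = (F/Z)·Haar^{⊗E}`, proposal `q` = the exact autoregression closing all plaquettes of `C_ℓ` at link `ℓ`, exact sampler
`K = indepMH q (Z/∏N)`, cold configuration `U ≡ 1` = the mode of the importance weight, `A = Z/∏_ℓ c_{#C_ℓ}` its acceptance
mass (GEN-28 `allClosing_cold_acceptMass_eq`); `r = 1 − A`; path space = Mathlib `Kernel.trajMeasure`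
(`P_cold` from the cold configuration, `P_π` the equilibrium run).

The abstract file `Exactness/IMHColdStartInvariantEvents` (this generation): from the mode, every shift-invariant event of the
run has exactly its equilibrium probability (the mixture law with `1 − (1 − A)^b > 0` cancelled).  For the exact all-closing conditioner:

* **`allClosing_coldStart_shiftInvariant`** — for every measurable set of runs `E` with `θ_b⁻¹E = E` for some `b ≥ 1` (tail events of period
  `b` included): `P_cold(E) = P_π(E)` EXACTLY;
* **`allClosing_coldStart_shiftInvariant_integral`** — for every bounded measurable statistic `F` with `F ∘ θ_b = F`: `E_cold[F] = E_π[F]`;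
* **`allClosing_coldStart_shiftInvariant_ae`** — `P_π(E) = 1 ↔ P_cold(E) = 1`: every shift-invariant almost-sure property of the equilibrium
  run (convergence of time averages, of windowed autocovariance ∕ `τ_int` estimators, of empirical quantiles …) holds almost surely
  from the cold start and conversely, with EQUAL exceptional probabilities.

NOT CLAIMED: non-cold starts (the tree's `IMHErgodicEveryStart` transfers full-measure invariant events to every start);
events that are only asymptotically invariant.

The `Fact` instance is the measurability of the kernel weight (discharged by the measurability clause of GEN-28's
acceptance-mass theorem).  No `def`, no `sorry`, nothing cited as a fact beyond the tree.
-/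

noncomputable section

namespace Summit.Ventures.LatticeQCDFlow.Theory2.Autoregressive

open MeasureTheory ProbabilityTheory Function Finset
open scoped ENNReal
open Literature.MathematicalPhysics.QuantumFieldTheory Literature.MathematicalPhysics.QuantumLattice
open Summit.Ventures.LatticeQCDFlow.Exactness Summit.Ventures.LatticeQCDFlow.Scoring

variable {d L : ℕ} [NeZero L] {G : Type*} [Group G] [TopologicalSpace G] [IsTopologicalGroup G]
  [CompactSpace G] [SecondCountableTopology G] [MeasurableSpace G] [BorelSpace G]
/-- **EVERY SHIFT-INVARIANT EVENT OF THE RUN HAS ITS EQUILIBRIUM PROBABILITY FROM THE COLD START** (exact all-closing conditioner): `θ_b⁻¹E = E`, `b ≥ 1` ⇒ `P_cold(E) = P_π(E)`. [ours] -/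
theorem allClosing_coldStart_shiftInvariant [MeasurableSingletonClass G] (hL : 2 ≤ L) {w : G → ℝ} (hw : Continuous w) {m M : ℝ} (hm0 : 0 < m)
    (hm : ∀ g, m ≤ w g) (hM : ∀ g, w g ≤ M) (hwinv : ∀ g, w g⁻¹ = w g)
    (T : Finset (Edge d L)) (C : Edge d L → Finset (Plaquette d L))
    (hCne : ∀ ℓ ∈ T, (C ℓ).Nonempty)
    (hCe : ∀ ℓ ∈ T, ∀ p ∈ C ℓ, ℓ ∈ ({(p.1, p.2.1.1), (p.1.shift p.2.1.1, p.2.1.2),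
        (p.1.shift p.2.1.2, p.2.1.1), (p.1, p.2.1.2)} : Finset (Edge d L)))
    (hdisj : ∀ ℓ ∈ T, ∀ ℓ' ∈ T, ℓ ≠ ℓ' → Disjoint (C ℓ) (C ℓ'))
    (hcover : ∀ p : Plaquette d L, ∃ ℓ ∈ T, p ∈ C ℓ)
    (π q : Measure (GaugeConfig d L G)) [IsProbabilityMeasure π] [IsProbabilityMeasure q]
    (hπ : π = (Measure.pi fun _ : Edge d L => haarProbability G).withDensity fun U =>
      ENNReal.ofReal ((∏ p : Plaquette d L, w (plaquetteHolonomy U p.1 p.2.1.1 p.2.1.2)) /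
        ∫ V, ∏ p : Plaquette d L, w (plaquetteHolonomy V p.1 p.2.1.1 p.2.1.2) ∂(Measure.pi fun _ : Edge d L => haarProbability G)))
    (hq : q = (Measure.pi fun _ : Edge d L => haarProbability G).withDensity fun U =>
      ENNReal.ofReal (∏ ℓ ∈ T, (∏ p ∈ C ℓ, w (plaquetteHolonomy U p.1 p.2.1.1 p.2.1.2)) /
          (∫ v, ∏ p ∈ C ℓ, w (plaquetteHolonomy (update U ℓ v) p.1 p.2.1.1 p.2.1.2) ∂(haarProbability G))))
    [Fact (Measurable (fun U =>
        (((∫ V, ∏ p : Plaquette d L, w (plaquetteHolonomy V p.1 p.2.1.1 p.2.1.2) ∂(Measure.pi fun _ : Edge d L => haarProbability G)) /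
          ∏ ℓ ∈ T, (∫ v, ∏ p ∈ C ℓ, w (plaquetteHolonomy (update U ℓ v) p.1 p.2.1.1 p.2.1.2) ∂(haarProbability G))))⁻¹))]
    {E : Set (ℕ → GaugeConfig d L G)} (hE : MeasurableSet E) {b : ℕ} (hb : b ≠ 0)
    (hinv : (fun (x : ℕ → GaugeConfig d L G) (n : ℕ) => x (b + n)) ⁻¹' E = E) :
    (Kernel.trajMeasure (X := fun _ : ℕ => GaugeConfig d L G) (Measure.dirac (fun _ : Edge d L => (1 : G)))
        (fun n : ℕ => (indepMH q (fun U =>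
        (((∫ V, ∏ p : Plaquette d L, w (plaquetteHolonomy V p.1 p.2.1.1 p.2.1.2) ∂(Measure.pi fun _ : Edge d L => haarProbability G)) /
          ∏ ℓ ∈ T, (∫ v, ∏ p ∈ C ℓ, w (plaquetteHolonomy (update U ℓ v) p.1 p.2.1.1 p.2.1.2) ∂(haarProbability G))))⁻¹)).comap
          (fun h : (i : ↥(Finset.Iic n)) → GaugeConfig d L G => h ⟨n, Finset.mem_Iic.2 le_rfl⟩)
          (measurable_pi_apply _))).real E =
      (Kernel.trajMeasure (X := fun _ : ℕ => GaugeConfig d L G) π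
        (fun n : ℕ => (indepMH q (fun U =>
        (((∫ V, ∏ p : Plaquette d L, w (plaquetteHolonomy V p.1 p.2.1.1 p.2.1.2) ∂(Measure.pi fun _ : Edge d L => haarProbability G)) /
          ∏ ℓ ∈ T, (∫ v, ∏ p ∈ C ℓ, w (plaquetteHolonomy (update U ℓ v) p.1 p.2.1.1 p.2.1.2) ∂(haarProbability G))))⁻¹)).comap
          (fun h : (i : ↥(Finset.Iic n)) → GaugeConfig d L G => h ⟨n, Finset.mem_Iic.2 le_rfl⟩)
          (measurable_pi_apply _))).real E := by
  obtain ⟨hA, hρq, hmax, hρm, hρpos⟩ := allClosing_cold_acceptMass_eq hL hw hm0 hm hM hwinv T C hCne hCe hdisj hcover π q hπ hq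
  set cold : GaugeConfig d L G := fun _ => (1 : G) with hcold
  set ρ : GaugeConfig d L G → ℝ := fun U =>
    (∫ V, ∏ p : Plaquette d L, w (plaquetteHolonomy V p.1 p.2.1.1 p.2.1.2) ∂(Measure.pi fun _ : Edge d L => haarProbability G)) /
      ∏ ℓ ∈ T, (∫ v, ∏ p ∈ C ℓ, w (plaquetteHolonomy (update U ℓ v) p.1 p.2.1.1 p.2.1.2) ∂(haarProbability G)) with hρ
  have hw0' : ∀ U, 0 < (ρ U)⁻¹ := fun U => inv_pos.2 (hρpos U)
  have hπ' : (q.withDensity fun U => ENNReal.ofReal (ρ U)⁻¹) = π := withDensity_inv_density hρm hρpos hρq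
  haveI : IsProbabilityMeasure (q.withDensity fun U => ENNReal.ofReal (ρ U)⁻¹) := by rw [hπ']; infer_instance
  have hone : ∫⁻ y, ENNReal.ofReal (ρ y)⁻¹ ∂q = ENNReal.ofReal 1 := by
    have h : π Set.univ = 1 := measure_univ
    rw [← hπ', withDensity_apply _ MeasurableSet.univ, Measure.restrict_univ] at h
    rw [h, ENNReal.ofReal_one]
  have hA' := imhAcceptMass_toReal_eq_of_forall_le (q := q) hw0' cold hmax zero_le_one hone
  have hrate : ((ρ cold)⁻¹)⁻¹ = (∫ V, ∏ p : Plaquette d L, w (plaquetteHolonomy V p.1 p.2.1.1 p.2.1.2) ∂(Measure.pi fun _ : Edge d L => haarProbability G)) /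
        ∏ ℓ ∈ T, ∫ h, w h ^ (C ℓ).card ∂(haarProbability G) := by
    rw [← hA, hA', one_div]
  have hrate' : (ρ cold)⁻¹ = ((∫ V, ∏ p : Plaquette d L, w (plaquetteHolonomy V p.1 p.2.1.1 p.2.1.2) ∂(Measure.pi fun _ : Edge d L => haarProbability G)) /
        ∏ ℓ ∈ T, ∫ h, w h ^ (C ℓ).card ∂(haarProbability G))⁻¹ := by
    rw [← hrate, inv_inv]
  have h := imh_chain_shiftInvariant_real_mode (q := q) hw0' hmax hE hb hinv (x₀ := cold)
  rw [hπ'] at h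
  exact h

/-- **EVERY SHIFT-INVARIANT BOUNDED STATISTIC HAS ITS EQUILIBRIUM EXPECTATION FROM THE COLD START** (exact all-closing conditioner). [ours] -/
theorem allClosing_coldStart_shiftInvariant_integral [MeasurableSingletonClass G] (hL : 2 ≤ L) {w : G → ℝ} (hw : Continuous w) {m M : ℝ} (hm0 : 0 < m)
    (hm : ∀ g, m ≤ w g) (hM : ∀ g, w g ≤ M) (hwinv : ∀ g, w g⁻¹ = w g)
    (T : Finset (Edge d L)) (C : Edge d L → Finset (Plaquette d L))
    (hCne : ∀ ℓ ∈ T, (C ℓ).Nonempty)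
    (hCe : ∀ ℓ ∈ T, ∀ p ∈ C ℓ, ℓ ∈ ({(p.1, p.2.1.1), (p.1.shift p.2.1.1, p.2.1.2),
        (p.1.shift p.2.1.2, p.2.1.1), (p.1, p.2.1.2)} : Finset (Edge d L)))
    (hdisj : ∀ ℓ ∈ T, ∀ ℓ' ∈ T, ℓ ≠ ℓ' → Disjoint (C ℓ) (C ℓ'))
    (hcover : ∀ p : Plaquette d L, ∃ ℓ ∈ T, p ∈ C ℓ)
    (π q : Measure (GaugeConfig d L G)) [IsProbabilityMeasure π] [IsProbabilityMeasure q]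
    (hπ : π = (Measure.pi fun _ : Edge d L => haarProbability G).withDensity fun U =>
      ENNReal.ofReal ((∏ p : Plaquette d L, w (plaquetteHolonomy U p.1 p.2.1.1 p.2.1.2)) /
        ∫ V, ∏ p : Plaquette d L, w (plaquetteHolonomy V p.1 p.2.1.1 p.2.1.2) ∂(Measure.pi fun _ : Edge d L => haarProbability G)))
    (hq : q = (Measure.pi fun _ : Edge d L => haarProbability G).withDensity fun U =>
      ENNReal.ofReal (∏ ℓ ∈ T, (∏ p ∈ C ℓ, w (plaquetteHolonomy U p.1 p.2.1.1 p.2.1.2)) /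
          (∫ v, ∏ p ∈ C ℓ, w (plaquetteHolonomy (update U ℓ v) p.1 p.2.1.1 p.2.1.2) ∂(haarProbability G))))
    [Fact (Measurable (fun U =>
        (((∫ V, ∏ p : Plaquette d L, w (plaquetteHolonomy V p.1 p.2.1.1 p.2.1.2) ∂(Measure.pi fun _ : Edge d L => haarProbability G)) /
          ∏ ℓ ∈ T, (∫ v, ∏ p ∈ C ℓ, w (plaquetteHolonomy (update U ℓ v) p.1 p.2.1.1 p.2.1.2) ∂(haarProbability G))))⁻¹))]
    {F : (ℕ → GaugeConfig d L G) → ℝ} (hF : Measurable F) {CF : ℝ} (hCF : ∀ x, |F x| ≤ CF) {b : ℕ} (hb : b ≠ 0)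
    (hinv : ∀ x : ℕ → GaugeConfig d L G, F (fun n => x (b + n)) = F x) :
    ∫ x, F x ∂(Kernel.trajMeasure (X := fun _ : ℕ => GaugeConfig d L G) (Measure.dirac (fun _ : Edge d L => (1 : G)))
        (fun n : ℕ => (indepMH q (fun U =>
        (((∫ V, ∏ p : Plaquette d L, w (plaquetteHolonomy V p.1 p.2.1.1 p.2.1.2) ∂(Measure.pi fun _ : Edge d L => haarProbability G)) /
          ∏ ℓ ∈ T, (∫ v, ∏ p ∈ C ℓ, w (plaquetteHolonomy (update U ℓ v) p.1 p.2.1.1 p.2.1.2) ∂(haarProbability G))))⁻¹)).comap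
          (fun h : (i : ↥(Finset.Iic n)) → GaugeConfig d L G => h ⟨n, Finset.mem_Iic.2 le_rfl⟩)
          (measurable_pi_apply _))) =
      ∫ x, F x ∂(Kernel.trajMeasure (X := fun _ : ℕ => GaugeConfig d L G) π
        (fun n : ℕ => (indepMH q (fun U =>
        (((∫ V, ∏ p : Plaquette d L, w (plaquetteHolonomy V p.1 p.2.1.1 p.2.1.2) ∂(Measure.pi fun _ : Edge d L => haarProbability G)) /
          ∏ ℓ ∈ T, (∫ v, ∏ p ∈ C ℓ, w (plaquetteHolonomy (update U ℓ v) p.1 p.2.1.1 p.2.1.2) ∂(haarProbability G))))⁻¹)).comap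
          (fun h : (i : ↥(Finset.Iic n)) → GaugeConfig d L G => h ⟨n, Finset.mem_Iic.2 le_rfl⟩)
          (measurable_pi_apply _))) := by
  obtain ⟨hA, hρq, hmax, hρm, hρpos⟩ := allClosing_cold_acceptMass_eq hL hw hm0 hm hM hwinv T C hCne hCe hdisj hcover π q hπ hq
  set cold : GaugeConfig d L G := fun _ => (1 : G) with hcold
  set ρ : GaugeConfig d L G → ℝ := fun U =>
    (∫ V, ∏ p : Plaquette d L, w (plaquetteHolonomy V p.1 p.2.1.1 p.2.1.2) ∂(Measure.pi fun _ : Edge d L => haarProbability G)) /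
      ∏ ℓ ∈ T, (∫ v, ∏ p ∈ C ℓ, w (plaquetteHolonomy (update U ℓ v) p.1 p.2.1.1 p.2.1.2) ∂(haarProbability G)) with hρ
  have hw0' : ∀ U, 0 < (ρ U)⁻¹ := fun U => inv_pos.2 (hρpos U)
  have hπ' : (q.withDensity fun U => ENNReal.ofReal (ρ U)⁻¹) = π := withDensity_inv_density hρm hρpos hρq
  haveI : IsProbabilityMeasure (q.withDensity fun U => ENNReal.ofReal (ρ U)⁻¹) := by rw [hπ']; infer_instance
  have hone : ∫⁻ y, ENNReal.ofReal (ρ y)⁻¹ ∂q = ENNReal.ofReal 1 := by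
    have h : π Set.univ = 1 := measure_univ
    rw [← hπ', withDensity_apply _ MeasurableSet.univ, Measure.restrict_univ] at h
    rw [h, ENNReal.ofReal_one]
  have hA' := imhAcceptMass_toReal_eq_of_forall_le (q := q) hw0' cold hmax zero_le_one hone
  have hrate : ((ρ cold)⁻¹)⁻¹ = (∫ V, ∏ p : Plaquette d L, w (plaquetteHolonomy V p.1 p.2.1.1 p.2.1.2) ∂(Measure.pi fun _ : Edge d L => haarProbability G)) /
        ∏ ℓ ∈ T, ∫ h, w h ^ (C ℓ).card ∂(haarProbability G) := by
    rw [← hA, hA', one_div]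
  have hrate' : (ρ cold)⁻¹ = ((∫ V, ∏ p : Plaquette d L, w (plaquetteHolonomy V p.1 p.2.1.1 p.2.1.2) ∂(Measure.pi fun _ : Edge d L => haarProbability G)) /
        ∏ ℓ ∈ T, ∫ h, w h ^ (C ℓ).card ∂(haarProbability G))⁻¹ := by
    rw [← hrate, inv_inv]
  have h := imh_chain_shiftInvariant_integral_mode (q := q) hw0' hmax hF hCF hb hinv (x₀ := cold)
  rw [hπ'] at h
  exact h

/-- **SHIFT-INVARIANT ALMOST-SURE PROPERTIES TRANSFER BOTH WAYS** (exact all-closing conditioner): `P_cold(Eᶜ) = P_π(Eᶜ)` and `P_π(E) = 1 ↔ P_cold(E) = 1`. [ours] -/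
theorem allClosing_coldStart_shiftInvariant_ae [MeasurableSingletonClass G] (hL : 2 ≤ L) {w : G → ℝ} (hw : Continuous w) {m M : ℝ} (hm0 : 0 < m)
    (hm : ∀ g, m ≤ w g) (hM : ∀ g, w g ≤ M) (hwinv : ∀ g, w g⁻¹ = w g)
    (T : Finset (Edge d L)) (C : Edge d L → Finset (Plaquette d L))
    (hCne : ∀ ℓ ∈ T, (C ℓ).Nonempty)
    (hCe : ∀ ℓ ∈ T, ∀ p ∈ C ℓ, ℓ ∈ ({(p.1, p.2.1.1), (p.1.shift p.2.1.1, p.2.1.2),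
        (p.1.shift p.2.1.2, p.2.1.1), (p.1, p.2.1.2)} : Finset (Edge d L)))
    (hdisj : ∀ ℓ ∈ T, ∀ ℓ' ∈ T, ℓ ≠ ℓ' → Disjoint (C ℓ) (C ℓ'))
    (hcover : ∀ p : Plaquette d L, ∃ ℓ ∈ T, p ∈ C ℓ)
    (π q : Measure (GaugeConfig d L G)) [IsProbabilityMeasure π] [IsProbabilityMeasure q]
    (hπ : π = (Measure.pi fun _ : Edge d L => haarProbability G).withDensity fun U =>
      ENNReal.ofReal ((∏ p : Plaquette d L, w (plaquetteHolonomy U p.1 p.2.1.1 p.2.1.2)) /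
        ∫ V, ∏ p : Plaquette d L, w (plaquetteHolonomy V p.1 p.2.1.1 p.2.1.2) ∂(Measure.pi fun _ : Edge d L => haarProbability G)))
    (hq : q = (Measure.pi fun _ : Edge d L => haarProbability G).withDensity fun U =>
      ENNReal.ofReal (∏ ℓ ∈ T, (∏ p ∈ C ℓ, w (plaquetteHolonomy U p.1 p.2.1.1 p.2.1.2)) /
          (∫ v, ∏ p ∈ C ℓ, w (plaquetteHolonomy (update U ℓ v) p.1 p.2.1.1 p.2.1.2) ∂(haarProbability G))))
    [Fact (Measurable (fun U =>
        (((∫ V, ∏ p : Plaquette d L, w (plaquetteHolonomy V p.1 p.2.1.1 p.2.1.2) ∂(Measure.pi fun _ : Edge d L => haarProbability G)) /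
          ∏ ℓ ∈ T, (∫ v, ∏ p ∈ C ℓ, w (plaquetteHolonomy (update U ℓ v) p.1 p.2.1.1 p.2.1.2) ∂(haarProbability G))))⁻¹))]
    {E : Set (ℕ → GaugeConfig d L G)} (hE : MeasurableSet E) {b : ℕ} (hb : b ≠ 0)
    (hinv : (fun (x : ℕ → GaugeConfig d L G) (n : ℕ) => x (b + n)) ⁻¹' E = E) :
    (Kernel.trajMeasure (X := fun _ : ℕ => GaugeConfig d L G) (Measure.dirac (fun _ : Edge d L => (1 : G)))
        (fun n : ℕ => (indepMH q (fun U =>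
        (((∫ V, ∏ p : Plaquette d L, w (plaquetteHolonomy V p.1 p.2.1.1 p.2.1.2) ∂(Measure.pi fun _ : Edge d L => haarProbability G)) /
          ∏ ℓ ∈ T, (∫ v, ∏ p ∈ C ℓ, w (plaquetteHolonomy (update U ℓ v) p.1 p.2.1.1 p.2.1.2) ∂(haarProbability G))))⁻¹)).comap
          (fun h : (i : ↥(Finset.Iic n)) → GaugeConfig d L G => h ⟨n, Finset.mem_Iic.2 le_rfl⟩)
          (measurable_pi_apply _))) Eᶜ =
      (Kernel.trajMeasure (X := fun _ : ℕ => GaugeConfig d L G) π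
        (fun n : ℕ => (indepMH q (fun U =>
        (((∫ V, ∏ p : Plaquette d L, w (plaquetteHolonomy V p.1 p.2.1.1 p.2.1.2) ∂(Measure.pi fun _ : Edge d L => haarProbability G)) /
          ∏ ℓ ∈ T, (∫ v, ∏ p ∈ C ℓ, w (plaquetteHolonomy (update U ℓ v) p.1 p.2.1.1 p.2.1.2) ∂(haarProbability G))))⁻¹)).comap
          (fun h : (i : ↥(Finset.Iic n)) → GaugeConfig d L G => h ⟨n, Finset.mem_Iic.2 le_rfl⟩)
          (measurable_pi_apply _))) Eᶜ ∧
    ((Kernel.trajMeasure (X := fun _ : ℕ => GaugeConfig d L G) π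
        (fun n : ℕ => (indepMH q (fun U =>
        (((∫ V, ∏ p : Plaquette d L, w (plaquetteHolonomy V p.1 p.2.1.1 p.2.1.2) ∂(Measure.pi fun _ : Edge d L => haarProbability G)) /
          ∏ ℓ ∈ T, (∫ v, ∏ p ∈ C ℓ, w (plaquetteHolonomy (update U ℓ v) p.1 p.2.1.1 p.2.1.2) ∂(haarProbability G))))⁻¹)).comap
          (fun h : (i : ↥(Finset.Iic n)) → GaugeConfig d L G => h ⟨n, Finset.mem_Iic.2 le_rfl⟩)
          (measurable_pi_apply _))) E = 1 ↔
      (Kernel.trajMeasure (X := fun _ : ℕ => GaugeConfig d L G) (Measure.dirac (fun _ : Edge d L => (1 : G)))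
        (fun n : ℕ => (indepMH q (fun U =>
        (((∫ V, ∏ p : Plaquette d L, w (plaquetteHolonomy V p.1 p.2.1.1 p.2.1.2) ∂(Measure.pi fun _ : Edge d L => haarProbability G)) /
          ∏ ℓ ∈ T, (∫ v, ∏ p ∈ C ℓ, w (plaquetteHolonomy (update U ℓ v) p.1 p.2.1.1 p.2.1.2) ∂(haarProbability G))))⁻¹)).comap
          (fun h : (i : ↥(Finset.Iic n)) → GaugeConfig d L G => h ⟨n, Finset.mem_Iic.2 le_rfl⟩)
          (measurable_pi_apply _))) E = 1) := by
  obtain ⟨hA, hρq, hmax, hρm, hρpos⟩ := allClosing_cold_acceptMass_eq hL hw hm0 hm hM hwinv T C hCne hCe hdisj hcover π q hπ hq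
  set cold : GaugeConfig d L G := fun _ => (1 : G) with hcold
  set ρ : GaugeConfig d L G → ℝ := fun U =>
    (∫ V, ∏ p : Plaquette d L, w (plaquetteHolonomy V p.1 p.2.1.1 p.2.1.2) ∂(Measure.pi fun _ : Edge d L => haarProbability G)) /
      ∏ ℓ ∈ T, (∫ v, ∏ p ∈ C ℓ, w (plaquetteHolonomy (update U ℓ v) p.1 p.2.1.1 p.2.1.2) ∂(haarProbability G)) with hρ
  have hw0' : ∀ U, 0 < (ρ U)⁻¹ := fun U => inv_pos.2 (hρpos U)
  have hπ' : (q.withDensity fun U => ENNReal.ofReal (ρ U)⁻¹) = π := withDensity_inv_density hρm hρpos hρq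
  haveI : IsProbabilityMeasure (q.withDensity fun U => ENNReal.ofReal (ρ U)⁻¹) := by rw [hπ']; infer_instance
  have hone : ∫⁻ y, ENNReal.ofReal (ρ y)⁻¹ ∂q = ENNReal.ofReal 1 := by
    have h : π Set.univ = 1 := measure_univ
    rw [← hπ', withDensity_apply _ MeasurableSet.univ, Measure.restrict_univ] at h
    rw [h, ENNReal.ofReal_one]
  have hA' := imhAcceptMass_toReal_eq_of_forall_le (q := q) hw0' cold hmax zero_le_one hone
  have hrate : ((ρ cold)⁻¹)⁻¹ = (∫ V, ∏ p : Plaquette d L, w (plaquetteHolonomy V p.1 p.2.1.1 p.2.1.2) ∂(Measure.pi fun _ : Edge d L => haarProbability G)) /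
        ∏ ℓ ∈ T, ∫ h, w h ^ (C ℓ).card ∂(haarProbability G) := by
    rw [← hA, hA', one_div]
  have hrate' : (ρ cold)⁻¹ = ((∫ V, ∏ p : Plaquette d L, w (plaquetteHolonomy V p.1 p.2.1.1 p.2.1.2) ∂(Measure.pi fun _ : Edge d L => haarProbability G)) /
        ∏ ℓ ∈ T, ∫ h, w h ^ (C ℓ).card ∂(haarProbability G))⁻¹ := by
    rw [← hrate, inv_inv]
  have h := imh_chain_shiftInvariant_ae_mode (q := q) hw0' hmax hE hb hinv (x₀ := cold)
  rw [hπ'] at h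
  exact h


end Summit.Ventures.LatticeQCDFlow.Theory2.Autoregressive

end
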